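import Mathlib
import Summits.NavierStokesRegularity.NavierStokesRegularity.Theorems.FilamentSkeletonRssStadiumCornerRightDescentMid

/-!
# Route `FilamentSkeletonRss` · child crux `TangentSkeletonNearStraightL` (stmt-NavierStokesRegularity-23320) · registered line
# `child_tangent_analytic_strip_L` (b0b56c52900dd90a), stub `stub_stripPropagation` — assembly: QUANTITATIVE MARGIN OF THE VARIANCE CERTIFICATE

The gap form of `Theorems.StadiumCornerRightDescentMid` for the BOUND step of the retyped blueprint: `corner_descent_variance_re_ge_of_num`
(free starting radius, gap `g`: `g/a² ≤ Re q`), `poly_mid_gap` (the quartic with the gap `0.0005`), and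
  `corner_right_descent_mid_re_ge` — `(0.06·hs)² ≤ Re Σᵢ (Fᵢ(ζ(f)) − Fᵢ(z))²` for the middle descent `2/5 ≤ f ≤ 11/20` (every `Rb`).
Same proofs as the positivity versions with the gap carried.
HONEST FRAMING: bookkeeping for a HYPOTHETICAL filament skeleton on the NEGATIVE side of a MODEL route; the stub `stub_stripPropagation` is NOT
closed by this file; nothing here bears on Navier–Stokes regularity or blow-up.  `--supports stmt-NavierStokesRegularity-23320`.
-/

set_option linter.dupNamespace false

noncomputable section

namespace Summit.NavierStokesRegularity.NavierStokesRegularity.Theorems.StadiumCornerQuantVariance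

open Set Metric MeasureTheory
open scoped BigOperators
open Summit.NavierStokesRegularity.NavierStokesRegularity.Theorems.StadiumPairAveragingIntegrable
open Summit.NavierStokesRegularity.NavierStokesRegularity.Theorems.StadiumSplitProfile
open Summit.NavierStokesRegularity.NavierStokesRegularity.Theorems.StadiumChordModulusAffine
open Summit.NavierStokesRegularity.NavierStokesRegularity.Theorems.StadiumChordVariance
open Summit.NavierStokesRegularity.NavierStokesRegularity.Theorems.StadiumLegProfiles
open Summit.NavierStokesRegularity.NavierStokesRegularity.Theorems.StadiumPartnerPiece
open Summit.NavierStokesRegularity.NavierStokesRegularity.Theorems.StadiumLogBounds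
open Summit.NavierStokesRegularity.NavierStokesRegularity.Theorems.StadiumCornerRightDescentVariance
open Summit.NavierStokesRegularity.NavierStokesRegularity.Theorems.StadiumCornerRightDescentMid

/-- **Descent sources of the right corner by the averaged second-order chord bound, reduced to one number.**  Stadium
`S = {|Im| < hs, |Re − cc| < L + hs}`, `F` holomorphic on `S` with `‖F′‖ ≤ 2` and `Σ (F′)ᵢ² = 1`; target `z = x₀ + iY` (`0 ≤ Y < hs/4`,
`cc ≤ x₀ < cc + L + hs/4`, `Y < hs/4`); source `ζ = (x₀ + a) + iη` with `0 < a`, `0 ≤ η ≤ Y`, `Y − η ≤ bs ≤ a`; a FREE starting radius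
`0 < d₀ ≤ 3hs/4 − a` of the affine Cauchy radius `d₀ + a·r` along the chord (version of
`Theorems.StadiumCornerRightDescentVariance.corner_descent_variance_re_pos_of_num`, which is `d₀ = 3hs/4 − a`); `κ = a/d₀`,
`M₁ = ((1+κ)log(1+κ) − κ)/κ`, `M₂ = ((1+κ)log²(1+κ) − 2(1+κ)log(1+κ) + 2κ)/κ`.  QUANTITATIVE form: if
`12(a² + bs²)(M₂ − M₁²)(a² − bs² + 2a·bs) + g ≤ a²(a² − bs²)` then `g/a² ≤ Re Σᵢ (Fᵢ(ζ) − Fᵢ(z))²`. [folklore] -/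
theorem corner_descent_variance_re_ge_of_num {hs L cc : ℝ} {F : ℂ → (Fin 3 → ℂ)}
    (hF : DifferentiableOn ℂ F {z : ℂ | |z.im| < hs ∧ |z.re - cc| < L + hs})
    (hM : ∀ z ∈ {z : ℂ | |z.im| < hs ∧ |z.re - cc| < L + hs}, ‖deriv F z‖ ≤ 2)
    (hunit : ∀ w ∈ {z : ℂ | |z.im| < hs ∧ |z.re - cc| < L + hs}, ∑ i, (deriv F w i) ^ 2 = 1)
    (hhs : 0 < hs) {x₀ Y a η bs d₀ g : ℝ} (hY : Y < hs / 4) (hx₀ : x₀ < cc + L + hs / 4) (hx₀cc : cc ≤ x₀)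
    (ha0 : 0 < a) (hd₀pos : 0 < d₀) (hd₀le : d₀ ≤ 3 * hs / 4 - a) (hη0 : 0 ≤ η) (hηY : η ≤ Y) (hb : Y - η ≤ bs) (hbs : bs ≤ a)
    (hnum : 12 * (a ^ 2 + bs ^ 2) *
        ((((1 + a / d₀) * Real.log (1 + a / d₀) ^ 2 -
            2 * (1 + a / d₀) * Real.log (1 + a / d₀) + 2 * (a / d₀)) /
            (a / d₀)) -
          (((1 + a / d₀) * Real.log (1 + a / d₀) - a / d₀) /
            (a / d₀)) ^ 2) *
        (a ^ 2 - bs ^ 2 + 2 * a * bs) + g ≤ a ^ 2 * (a ^ 2 - bs ^ 2)) :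
    g / a ^ 2 ≤ (∑ i, (F (((x₀ + a : ℝ) : ℂ) + (η : ℂ) * Complex.I) i - F ((x₀ : ℂ) + (Y : ℂ) * Complex.I) i) ^ 2).re := by
  set S : Set ℂ := {z : ℂ | |z.im| < hs ∧ |z.re - cc| < L + hs} with hS
  have hSo : IsOpen S := isOpen_stadium hs (L + hs) cc
  set b : ℝ := Y - η with hbdef
  have hb0 : 0 ≤ b := by rw [hbdef]; linarith
  have hba : b ≤ a := hb.trans hbs
  -- source, chord, target
  set zs : ℂ := ((x₀ + a : ℝ) : ℂ) + (η : ℂ) * Complex.I with hzs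
  set s : ℂ := ((-a : ℝ) : ℂ) + (b : ℂ) * Complex.I with hsdef
  have hsre : s.re = -a := by simp [hsdef]
  have hsim : s.im = b := by simp [hsdef]
  have hzsre : zs.re = x₀ + a := by simp [hzs]
  have hzsim : zs.im = η := by simp [hzs]
  have htarget : zs + s = (x₀ : ℂ) + (Y : ℂ) * Complex.I := by
    apply Complex.ext
    · simp [hzs, hsdef]
    · simp [hzs, hsdef, hbdef]
  have hs2re : (s ^ 2).re = a ^ 2 - b ^ 2 := by rw [pow_two, Complex.mul_re, hsre, hsim]; ring
  have hs2im : (s ^ 2).im = -(2 * a * b) := by rw [pow_two, Complex.mul_im, hsre, hsim]; ring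
  have hnorm2 : ‖s‖ ^ 2 = a ^ 2 + b ^ 2 := by rw [Complex.sq_norm, Complex.normSq_apply, hsre, hsim]; ring
  -- the chord points and the Cauchy discs about them lie in `S`
  have hchord_re : ∀ r ∈ Icc (0:ℝ) 1, (zs + (r : ℂ) * s).re = x₀ + a - r * a := by
    intro r hr; simp [hzs, hsdef]; ring
  have hchord_im : ∀ r ∈ Icc (0:ℝ) 1, (zs + (r : ℂ) * s).im = η + r * b := by
    intro r hr; simp [hzs, hsdef]
  have hball : ∀ r ∈ Icc (0:ℝ) 1, closedBall (zs + (r : ℂ) * s) (d₀ + a * r) ⊆ S := by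
    intro r hr w hw
    rw [mem_closedBall, dist_eq_norm] at hw
    have him := (Complex.abs_im_le_norm (w - (zs + (r : ℂ) * s))).trans hw
    have hre := (Complex.abs_re_le_norm (w - (zs + (r : ℂ) * s))).trans hw
    rw [Complex.sub_im, hchord_im r hr] at him
    rw [Complex.sub_re, hchord_re r hr] at hre
    have hrb : r * b ≤ b := mul_le_of_le_one_left hb0 hr.2
    have hrb0 : 0 ≤ r * b := mul_nonneg hr.1 hb0
    have hra : 0 ≤ r * a := mul_nonneg hr.1 ha0.le
    have hra1 : r * a ≤ a := mul_le_of_le_one_left ha0.le hr.2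
    have hd₀a : d₀ + a ≤ 3 * hs / 4 := by linarith only [hd₀le]
    refine ⟨?_, ?_⟩
    · have h1 := abs_le.1 him
      rw [abs_lt]
      constructor
      · linarith only [h1.1, hrb0, hη0, hra1, hd₀a, hY, hhs, hra, hd₀le, hd₀pos]
      · linarith only [h1.2, hrb, hra, hd₀a, hY, hηY, hbdef, hra1, ha0]
    · have h1 := abs_le.1 hre
      rw [abs_lt]
      constructor
      · linarith only [h1.1, hra1, hra, hd₀a, hx₀, hx₀cc, hhs, ha0]
      · linarith only [h1.2, hra, hra1, hd₀a, hx₀, hx₀cc]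
  have hseg : ∀ r ∈ Icc (0:ℝ) 1, zs + (r : ℂ) * s ∈ S := fun r hr =>
    hball r hr (mem_closedBall_self (by have := mul_nonneg ha0.le hr.1; linarith))
  -- the Lipschitz modulus along the chord (affine radius `d₀ + a r`)
  have hLip0 := fun (r r' : ℝ) (hr : r ∈ Icc (0:ℝ) 1) (hr' : r' ∈ Icc (0:ℝ) 1) =>
    chord_modulus_affine_le (M := 2) hSo hF hM (z := zs) (s := s) (d₀ := d₀) (d₁ := a) ha0.ne' hd₀pos (by linarith) hball hr hr'
  -- `log(d₀ + a r) − log d₀ = log(1 + κ r)`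
  set κ : ℝ := a / d₀ with hκdef
  have hκpos : 0 < κ := div_pos ha0 hd₀pos
  have hlog : ∀ r ∈ Icc (0:ℝ) 1, Real.log (d₀ + a * r) - Real.log d₀ = Real.log (1 + κ * r) := by
    intro r hr
    have h1 : 0 < d₀ + a * r := by have := mul_nonneg ha0.le hr.1; linarith
    rw [← Real.log_div h1.ne' hd₀pos.ne']
    congr 1
    rw [hκdef]; field_simp
  -- the clamped (globally continuous) modulus
  set c : ℝ := ‖s‖ * 2 / a with hcdef
  have hc0 : 0 ≤ c := by rw [hcdef]; positivity
  set G : ℝ → ℝ := fun r => c * Real.log (1 + κ * max 0 (min r 1)) with hGdef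
  have hlin : Continuous fun r : ℝ => 1 + κ * max 0 (min r 1) :=
    continuous_const.add (continuous_const.mul (continuous_clamp 1))
  have hlin_ne : ∀ r : ℝ, 1 + κ * max 0 (min r 1) ≠ 0 := fun r => by
    have := mul_nonneg hκpos.le (clamp_mem zero_le_one r).1
    exact ne_of_gt (by linarith)
  have hlogcl : Continuous fun r : ℝ => Real.log (1 + κ * max 0 (min r 1)) := hlin.log hlin_ne
  have hGc : Continuous G := continuous_const.mul hlogcl
  have hGeq : ∀ r ∈ Icc (0:ℝ) 1, G r = c * Real.log (1 + κ * r) := by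
    intro r hr; simp only [hGdef, clamp_eq hr]
  have hGmono : ∀ r ∈ Icc (0:ℝ) 1, ∀ r' ∈ Icc (0:ℝ) 1, r ≤ r' → G r ≤ G r' := by
    intro r hr r' hr' hrr'
    rw [hGeq r hr, hGeq r' hr']
    have h1 : 0 < 1 + κ * r := by have := mul_nonneg hκpos.le hr.1; linarith only [this]
    have h2 : 1 + κ * r ≤ 1 + κ * r' := by have := mul_le_mul_of_nonneg_left hrr' hκpos.le; linarith only [this]
    exact mul_le_mul_of_nonneg_left (Real.log_le_log h1 h2) hc0
  have hLip : ∀ r ∈ Icc (0:ℝ) 1, ∀ r' ∈ Icc (0:ℝ) 1,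
      ‖deriv F (zs + (r : ℂ) * s) - deriv F (zs + (r' : ℂ) * s)‖ ≤ |G r - G r'| := by
    intro r hr r' hr'
    have h := hLip0 r r' hr hr'
    rw [hGeq r hr, hGeq r' hr', ← hlog r hr, ← hlog r' hr']
    exact h
  -- the pair bound: second order everywhere, capped by the full range
  set a_ : ℝ → (Fin 3 → ℂ) := fun r => deriv F (zs + (r : ℂ) * s) with ha_
  have hpair : ∀ r ∈ Icc (0:ℝ) 1, ∀ r' ∈ Icc (0:ℝ) 1, ‖∑ i, a_ r i * a_ r' i - 1‖ ≤ (3 / 2 : ℝ) * (G r - G r') ^ 2 := by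
    intro r hr r' hr'
    have hb1 := norm_sum_mul_sub_one_le (a_ r) (a_ r') (hunit _ (hseg r hr)) (hunit _ (hseg r' hr'))
    have hL := hLip r hr r' hr'
    have hsq : ‖a_ r - a_ r'‖ ^ 2 ≤ (G r - G r') ^ 2 := by
      have h := pow_le_pow_left₀ (norm_nonneg _) hL 2
      rwa [sq_abs] at h
    exact hb1.trans (mul_le_mul_of_nonneg_left hsq (by norm_num))
  have hcap : ∀ r ∈ Icc (0:ℝ) 1, ∀ r' ∈ Icc (0:ℝ) 1, (G r - G r') ^ 2 ≤ (G 1 - G 0) ^ 2 := by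
    intro r hr r' hr'
    have h0 : (0:ℝ) ∈ Icc (0:ℝ) 1 := ⟨le_rfl, zero_le_one⟩
    have h1 : (1:ℝ) ∈ Icc (0:ℝ) 1 := ⟨zero_le_one, le_rfl⟩
    have hr0 := hGmono 0 h0 r hr hr.1
    have hr1 := hGmono r hr 1 h1 hr.2
    have hr'0 := hGmono 0 h0 r' hr' hr'.1
    have hr'1 := hGmono r' hr' 1 h1 hr'.2
    rw [← sq_abs (G r - G r'), ← sq_abs (G 1 - G 0)]
    apply pow_le_pow_left₀ (abs_nonneg _)
    rw [abs_of_nonneg (by linarith : 0 ≤ G 1 - G 0)]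
    exact abs_le.2 ⟨by linarith, by linarith⟩
  set C : ℝ := (3 / 2 : ℝ) * (G 1 - G 0) ^ 2 with hC
  set φ : ℝ → ℝ → ℝ := fun r r' => if 0 < r ∧ 0 < r' then (3 / 2 : ℝ) * (G r - G r') ^ 2 else C with hφ
  have hφbound : ∀ r ∈ Icc (0:ℝ) 1, ∀ r' ∈ Icc (0:ℝ) 1, (3 / 2 : ℝ) * (G r - G r') ^ 2 ≤ φ r r' := by
    intro r hr r' hr'
    by_cases h : 0 < r ∧ 0 < r'
    · simp only [hφ, if_pos h]; exact le_rfl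
    · simp only [hφ, if_neg h, hC]
      exact mul_le_mul_of_nonneg_left (hcap r hr r' hr') (by norm_num)
  have hpairφ : ∀ r ∈ Icc (0:ℝ) 1, ∀ r' ∈ Icc (0:ℝ) 1, 1 - φ r r' ≤ (∑ i, a_ r i * a_ r' i).re := by
    intro r hr r' hr'
    have hn := (hpair r hr r' hr').trans (hφbound r hr r' hr')
    have h1 := Complex.abs_re_le_norm (∑ i, a_ r i * a_ r' i - 1)
    have h2 := neg_abs_le (∑ i, a_ r i * a_ r' i - 1).re
    rw [Complex.sub_re, Complex.one_re] at h1 h2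
    linarith
  have hpairψ : ∀ r ∈ Icc (0:ℝ) 1, ∀ r' ∈ Icc (0:ℝ) 1, |(∑ i, a_ r i * a_ r' i).im| ≤ φ r r' := by
    intro r hr r' hr'
    have hn := (hpair r hr r' hr').trans (hφbound r hr r' hr')
    have h1 := Complex.abs_im_le_norm (∑ i, a_ r i * a_ r' i - 1)
    rw [Complex.sub_im, Complex.one_im, sub_zero] at h1
    exact h1.trans hn
  obtain ⟨hφi, hΦi, hΦv⟩ := split_double_mean_eq (C := C) (θ := 0) le_rfl zero_le_one hGc
  have hb2 : b ^ 2 ≤ a ^ 2 := pow_le_pow_left₀ hb0 hba 2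
  have hs2 : 0 ≤ (s ^ 2).re := by rw [hs2re]; linarith only [hb2]
  have hmain := chord_sq_re_ge_of_pairwise_integrable hSo hF hseg hφi hΦi hφi hΦi hpairφ hpairψ hs2
  rw [hΦv] at hmain
  -- the variance in closed form: `3(∫G² − (∫G)²) = 3c²(M₂ − M₁²)`
  have hi : ∀ {f : ℝ → ℝ}, Continuous f → IntervalIntegrable f volume (0:ℝ) 1 := fun hf => hf.intervalIntegrable _ _
  have hlogc : ContinuousOn (fun r : ℝ => Real.log (1 + κ * r)) (uIcc (0:ℝ) 1) := by
    rw [uIcc_of_le zero_le_one]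
    refine ContinuousOn.log (continuousOn_const.add (continuousOn_const.mul continuousOn_id)) fun r hr => ?_
    have := mul_nonneg hκpos.le hr.1
    exact ne_of_gt (by simpa using (by linarith : (0:ℝ) < 1 + κ * r))
  have hlogi : IntervalIntegrable (fun r : ℝ => Real.log (1 + κ * r)) volume (0:ℝ) 1 := hlogc.intervalIntegrable
  have hlog2i : IntervalIntegrable (fun r : ℝ => Real.log (1 + κ * r) ^ 2) volume (0:ℝ) 1 := (hlogc.pow 2).intervalIntegrable
  set M₁ : ℝ := ∫ r in (0:ℝ)..1, Real.log (1 + κ * r) with hM₁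
  set M₂ : ℝ := ∫ r in (0:ℝ)..1, Real.log (1 + κ * r) ^ 2 with hM₂
  have hIG : ∫ r in (0:ℝ)..1, G r = c * M₁ := by
    rw [hM₁, ← intervalIntegral.integral_const_mul]
    refine intervalIntegral.integral_congr fun r hr => ?_
    rw [uIcc_of_le zero_le_one] at hr
    exact hGeq r hr
  have hIG2 : ∫ r in (0:ℝ)..1, G r ^ 2 = c ^ 2 * M₂ := by
    rw [hM₂, ← intervalIntegral.integral_const_mul]
    refine intervalIntegral.integral_congr fun r hr => ?_
    rw [uIcc_of_le zero_le_one] at hr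
    simp only [hGeq r hr]; ring
  have hvar0 : M₁ ^ 2 ≤ M₂ := by
    have h := sq_integral_le (g := fun r => Real.log (1 + κ * max 0 (min r 1))) hlogcl
    have e1 : ∫ r in (0:ℝ)..1, Real.log (1 + κ * max 0 (min r 1)) = M₁ := by
      rw [hM₁]; refine intervalIntegral.integral_congr fun r hr => ?_
      rw [uIcc_of_le zero_le_one] at hr; simp only [clamp_eq hr]
    have e2 : ∫ r in (0:ℝ)..1, Real.log (1 + κ * max 0 (min r 1)) ^ 2 = M₂ := by
      rw [hM₂]; refine intervalIntegral.integral_congr fun r hr => ?_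
      rw [uIcc_of_le zero_le_one] at hr; simp only [clamp_eq hr]
    rw [e1, e2] at h; exact h
  -- closed forms of `M₁`, `M₂`
  have hpos1 : ∀ r ∈ Icc (0:ℝ) 1, 0 < 1 + κ * r := fun r hr => by have := mul_nonneg hκpos.le hr.1; linarith
  have hM₁v : M₁ = ((1 + κ) * Real.log (1 + κ) - κ) / κ := by
    rw [hM₁, integral_log_affine (d₀ := 1) (d₁ := κ) (θ := 0) hκpos.ne' zero_le_one hpos1]
    simp only [mul_one, mul_zero, add_zero, Real.log_one]
    field_simp
    ring
  have hM₂v : M₂ = ((1 + κ) * Real.log (1 + κ) ^ 2 - 2 * (1 + κ) * Real.log (1 + κ) + 2 * κ) / κ := by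
    rw [hM₂, integral_log_sq_affine (d₀ := 1) (d₁ := κ) (θ := 0) hκpos.ne' zero_le_one hpos1]
    simp only [mul_one, mul_zero, add_zero, Real.log_one]
    field_simp
    ring
  -- the averaged bound with `V = 3c²(M₂ − M₁²) = 12(a²+b²)(M₂ − M₁²)/a²`
  set W : ℝ := M₂ - M₁ ^ 2 with hW
  have hW0 : 0 ≤ W := by rw [hW]; linarith
  have hVeq : 0 * (2 - 0) * C + 3 * ((1 - 0) * (∫ r in (0:ℝ)..1, G r ^ 2) - (∫ r in (0:ℝ)..1, G r) ^ 2) =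
      12 * (a ^ 2 + b ^ 2) * W / a ^ 2 := by
    rw [hIG, hIG2, hW]
    have hc2 : c ^ 2 = (a ^ 2 + b ^ 2) * 4 / a ^ 2 := by
      rw [hcdef, div_pow, mul_pow, hnorm2]; ring
    rw [mul_pow, hc2]
    field_simp
    ring
  rw [hVeq, hs2re, hs2im, abs_neg, abs_of_nonneg (by positivity : (0:ℝ) ≤ 2 * a * b)] at hmain
  -- monotone reduction `b ↦ bs` of the numeric hypothesis
  have hnumW : 12 * (a ^ 2 + bs ^ 2) * W * (a ^ 2 - bs ^ 2 + 2 * a * bs) + g ≤ a ^ 2 * (a ^ 2 - bs ^ 2) := by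
    have e : W = (((1 + a / d₀) * Real.log (1 + a / d₀) ^ 2 -
            2 * (1 + a / d₀) * Real.log (1 + a / d₀) + 2 * (a / d₀)) /
            (a / d₀)) -
          (((1 + a / d₀) * Real.log (1 + a / d₀) - a / d₀) /
            (a / d₀)) ^ 2 := by
      rw [hW, hM₁v, hM₂v]
    rw [e]; exact hnum
  have hnumb : 12 * (a ^ 2 + b ^ 2) * W * (a ^ 2 - b ^ 2 + 2 * a * b) + g ≤ a ^ 2 * (a ^ 2 - b ^ 2) := by
    have hbbs : b ^ 2 ≤ bs ^ 2 := pow_le_pow_left₀ hb0 hb 2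
    have h1 : a ^ 2 + b ^ 2 ≤ a ^ 2 + bs ^ 2 := by linarith only [hbbs]
    have h2 : a ^ 2 - b ^ 2 + 2 * a * b ≤ a ^ 2 - bs ^ 2 + 2 * a * bs := by
      have e : (a ^ 2 - bs ^ 2 + 2 * a * bs) - (a ^ 2 - b ^ 2 + 2 * a * b) = (bs - b) * (2 * a - bs - b) := by ring
      have key := mul_nonneg (sub_nonneg.2 hb) (show 0 ≤ 2 * a - bs - b by linarith only [hbs, hba])
      linarith only [key, e]
    have hab : 0 ≤ a * b := mul_nonneg ha0.le hb0
    have h3 : 0 ≤ a ^ 2 - b ^ 2 + 2 * a * b := by linarith only [hb2, hab]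
    have h4 : a ^ 2 * (a ^ 2 - bs ^ 2) ≤ a ^ 2 * (a ^ 2 - b ^ 2) :=
      mul_le_mul_of_nonneg_left (by linarith only [hbbs]) (sq_nonneg a)
    have h5 : 0 ≤ 12 * (a ^ 2 + bs ^ 2) * W := mul_nonneg (by positivity) hW0
    have hc : 12 * (a ^ 2 + b ^ 2) * W * (a ^ 2 - b ^ 2 + 2 * a * b) ≤
        12 * (a ^ 2 + bs ^ 2) * W * (a ^ 2 - bs ^ 2 + 2 * a * bs) := by
      apply mul_le_mul _ h2 h3 h5
      exact mul_le_mul_of_nonneg_right (mul_le_mul_of_nonneg_left h1 (by norm_num)) hW0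
    linarith only [hc, hnumW, h4]
  -- conclude
  have ha2 : 0 < a ^ 2 := by positivity
  have hkey : g / a ^ 2 ≤ (a ^ 2 - b ^ 2) * (1 - 12 * (a ^ 2 + b ^ 2) * W / a ^ 2) -
      2 * a * b * (12 * (a ^ 2 + b ^ 2) * W / a ^ 2) := by
    have e : (a ^ 2 - b ^ 2) * (1 - 12 * (a ^ 2 + b ^ 2) * W / a ^ 2) - 2 * a * b * (12 * (a ^ 2 + b ^ 2) * W / a ^ 2) =
        (a ^ 2 * (a ^ 2 - b ^ 2) - 12 * (a ^ 2 + b ^ 2) * W * (a ^ 2 - b ^ 2 + 2 * a * b)) / a ^ 2 := by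
      field_simp
      ring
    rw [e]
    exact div_le_div_of_nonneg_right (by linarith) ha2.le
  have hsym : (∑ i, (F (((x₀ + a : ℝ) : ℂ) + (η : ℂ) * Complex.I) i - F ((x₀ : ℂ) + (Y : ℂ) * Complex.I) i) ^ 2) =
      ∑ i, (F (zs + s) i - F zs i) ^ 2 := by
    rw [htarget]
    exact Finset.sum_congr rfl fun i _ => by ring
  rw [hsym]
  linarith only [hmain, hkey]


/-- **The quartic of the middle descent** (`ã = 1/5 + 3f/10`, `b̃ = f/4`, `W = 0.0368`):
`12(ã²+b̃²)·W·(ã²−b̃²+2ãb̃) ≤ ã²(ã²−b̃²)` on `[2/5, 11/20]` WITH the gap `0.0005`. [folklore] -/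
theorem poly_mid_gap {f : ℝ} (hf : 2 / 5 ≤ f) (hf' : f ≤ 11 / 20) :
    12 * ((1 / 5 + 3 / 10 * f) ^ 2 + (f / 4) ^ 2) * (0.0368 : ℝ) *
        ((1 / 5 + 3 / 10 * f) ^ 2 - (f / 4) ^ 2 + 2 * (1 / 5 + 3 / 10 * f) * (f / 4)) + 0.0005 ≤
      (1 / 5 + 3 / 10 * f) ^ 2 * ((1 / 5 + 3 / 10 * f) ^ 2 - (f / 4) ^ 2) := by
  have h1 : 0 ≤ f - 2 / 5 := by linarith
  have h2 : 0 ≤ 11 / 20 - f := by linarith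
  nlinarith [mul_nonneg h1 h2, mul_nonneg (mul_nonneg h1 h2) h1, mul_nonneg (mul_nonneg h1 h2) h2,
    mul_nonneg (mul_nonneg h1 h1) (mul_nonneg h2 h2), mul_nonneg (mul_nonneg h1 h2) (mul_nonneg h1 h2)]

/-- **The middle descent sources of the right corner, quantitative.**  Stadium `S = {|Im| < hs, |Re − cc| < L + hs}`, `F` holomorphic on
`S` with `‖F′‖ ≤ 2`, `Σ (F′)ᵢ² = 1`; target `z = x₀ + iY` with `0 ≤ Y < hs/4`, `cc ≤ x₀ < cc + L + hs/4`; descent source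
`ζ(f) = (x₀ + hs/5 + (3hs/10)f) + iY(1−f)` with `2/5 ≤ f ≤ 11/20`; QUANTITATIVE:
`(0.06·hs)² ≤ Re Σᵢ (Fᵢ(ζ(f)) − Fᵢ(z))²` — every `Rb` (no tangent-oscillation input). [folklore] -/
theorem corner_right_descent_mid_re_ge {hs L cc : ℝ} {F : ℂ → (Fin 3 → ℂ)}
    (hF : DifferentiableOn ℂ F {z : ℂ | |z.im| < hs ∧ |z.re - cc| < L + hs})
    (hM : ∀ z ∈ {z : ℂ | |z.im| < hs ∧ |z.re - cc| < L + hs}, ‖deriv F z‖ ≤ 2)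
    (hunit : ∀ w ∈ {z : ℂ | |z.im| < hs ∧ |z.re - cc| < L + hs}, ∑ i, (deriv F w i) ^ 2 = 1)
    (hhs : 0 < hs) {x₀ Y f : ℝ} (hY0 : 0 ≤ Y) (hY : Y < hs / 4) (hx₀ : x₀ < cc + L + hs / 4) (hx₀cc : cc ≤ x₀)
    (hf : 2 / 5 ≤ f) (hf' : f ≤ 11 / 20)
    :
    (0.06 * hs) ^ 2 ≤ (∑ i, (F (((x₀ + (hs / 5 + 3 * hs / 10 * f) : ℝ) : ℂ) + ((Y * (1 - f) : ℝ) : ℂ) * Complex.I) i -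
        F ((x₀ : ℂ) + (Y : ℂ) * Complex.I) i) ^ 2).re := by
  -- the reduced geometry
  have ha0 : 0 < hs / 5 + 3 * hs / 10 * f := by positivity
  have hd₀pos : 0 < 77 / 73 * (hs / 5 + 3 * hs / 10 * f) := by positivity
  have hd₀le : 77 / 73 * (hs / 5 + 3 * hs / 10 * f) ≤ 3 * hs / 4 - (hs / 5 + 3 * hs / 10 * f) := by nlinarith
  have hη0 : 0 ≤ Y * (1 - f) := mul_nonneg hY0 (by linarith)
  have hηY : Y * (1 - f) ≤ Y := by nlinarith
  have hb : Y - Y * (1 - f) ≤ hs * f / 4 := by nlinarith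
  have hbs : hs * f / 4 ≤ hs / 5 + 3 * hs / 10 * f := by nlinarith
  -- the constant ratio `κ = 73/77`
  have hratio : (hs / 5 + 3 * hs / 10 * f) / (77 / 73 * (hs / 5 + 3 * hs / 10 * f)) = 73 / 77 := by
    field_simp
  have hW := W_star_le
  have hP := poly_mid_gap hf hf'
  have ha2 : 0 < (hs / 5 + 3 * hs / 10 * f) ^ 2 := by positivity
  have hgoal : (0.06 * hs) ^ 2 ≤ 0.0005 * hs ^ 4 / (hs / 5 + 3 * hs / 10 * f) ^ 2 := by
    rw [le_div_iff₀ ha2]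
    have hf1 : (hs / 5 + 3 * hs / 10 * f) ^ 2 ≤ (hs * (73 / 200)) ^ 2 := by
      apply pow_le_pow_left₀ ha0.le; nlinarith
    nlinarith [hf1, pow_pos hhs 4, sq_nonneg hs]
  refine hgoal.trans ?_
  refine corner_descent_variance_re_ge_of_num hF hM hunit hhs hY hx₀ hx₀cc ha0 hd₀pos hd₀le hη0 hηY hb hbs ?_
  rw [hratio]
  -- scale the quartic by `hs⁴` and insert the variance number
  have hs4 : 0 < hs ^ 4 := by positivity
  have e1 : (hs / 5 + 3 * hs / 10 * f) = hs * (1 / 5 + 3 / 10 * f) := by ring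
  have e2 : hs * f / 4 = hs * (f / 4) := by ring
  rw [e1, e2]
  set A := (1 / 5 + 3 / 10 * f : ℝ) with hA
  set B := (f / 4 : ℝ) with hB
  set W := ((1 + (73 / 77 : ℝ)) * Real.log (1 + 73 / 77) ^ 2 - 2 * (1 + 73 / 77) * Real.log (1 + 73 / 77) + 2 * (73 / 77)) /
      (73 / 77) - (((1 + 73 / 77) * Real.log (1 + 73 / 77) - 73 / 77) / (73 / 77)) ^ 2 with hWdef
  have hX0 : 0 ≤ 12 * ((hs * A) ^ 2 + (hs * B) ^ 2) * ((hs * A) ^ 2 - (hs * B) ^ 2 + 2 * (hs * A) * (hs * B)) := by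
    have hA0 : 0 ≤ A := by rw [hA]; linarith
    have hB0 : 0 ≤ B := by rw [hB]; linarith
    have hBA : B ≤ A := by rw [hA, hB]; linarith
    have : 0 ≤ (hs * A) ^ 2 - (hs * B) ^ 2 := by
      have := pow_le_pow_left₀ (by positivity : 0 ≤ hs * B) (mul_le_mul_of_nonneg_left hBA hhs.le) 2
      linarith
    positivity
  have hchain : 12 * ((hs * A) ^ 2 + (hs * B) ^ 2) * W * ((hs * A) ^ 2 - (hs * B) ^ 2 + 2 * (hs * A) * (hs * B)) ≤
      (hs * A) ^ 2 * ((hs * A) ^ 2 - (hs * B) ^ 2) - 0.0005 * hs ^ 4 := by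
   calc 12 * ((hs * A) ^ 2 + (hs * B) ^ 2) * W * ((hs * A) ^ 2 - (hs * B) ^ 2 + 2 * (hs * A) * (hs * B))
      = W * (12 * ((hs * A) ^ 2 + (hs * B) ^ 2) * ((hs * A) ^ 2 - (hs * B) ^ 2 + 2 * (hs * A) * (hs * B))) := by ring
    _ ≤ 0.0368 * (12 * ((hs * A) ^ 2 + (hs * B) ^ 2) * ((hs * A) ^ 2 - (hs * B) ^ 2 + 2 * (hs * A) * (hs * B))) :=
        mul_le_mul_of_nonneg_right hW hX0
    _ = hs ^ 4 * (12 * (A ^ 2 + B ^ 2) * (0.0368 : ℝ) * (A ^ 2 - B ^ 2 + 2 * A * B)) := by ring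
    _ ≤ hs ^ 4 * (A ^ 2 * (A ^ 2 - B ^ 2) - 0.0005) := mul_le_mul_of_nonneg_left (by linarith) hs4.le
    _ = (hs * A) ^ 2 * ((hs * A) ^ 2 - (hs * B) ^ 2) - 0.0005 * hs ^ 4 := by ring
  linarith only [hchain]

end Summit.NavierStokesRegularity.NavierStokesRegularity.Theorems.StadiumCornerQuantVariance

end
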